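import Literature.Geometry.Lorentzian.KerrStarTimeFourier
import Literature.Geometry.Lorentzian.KerrStarAzimuthalModes
import Literature.Geometry.Lorentzian.KerrStarLaplacianPair
import Literature.Analysis.SpecialFunctions.OblateSpheroidalWeakPair
import HarnessLib

/-!
# Carter's separation in frequency space: the identity at fixed `r` for a.e. frequency

Dafermos–Rodnianski–Shlapentokh-Rothman, arXiv:1402.7034, §5.2.2–5.2.3 (Prop. 5.2.1, "Carter's
formal separation of the wave operator yields …"). Starting from the tree's coordinate form of
`ρ² □_g` in `(t*, r, θ, φ*)` (`Kerr.blSigma_mul_coordWave_starChart`), this file carries out the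
separation *in `L²`*: the angular slices are taken in `𝓚 = L²([-1,1] × 𝕋)` (`Kerr.angSlice`),
square integrability in `t*` puts them in `𝓗 = L²(ℝ; 𝓚)` (`Kerr.timeLp`), the `L²` Fourier
transform in `t*` gives `Kerr.freqLp`, and the result is paired with the oblate spheroidal
basis `Ψ_q(aω)` *for the frequency at hand*.

* `Kerr.sepRHS a M Φ q` — the separated right-hand side of the coordinate identity, written with
  coordinate derivatives `∂_i∂_j F` (`Kerr.dir`) of `F = Φ ∘ κ_a` and the continuous angular
  Laplacian `Kerr.sphLaplacianStar`; `Kerr.sepRHS_eq_of_coordWave`: the tree identity in this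
  language (`W = sepRHS` off the poles for `W = Σ · (□Φ) ∘ κ_a`);
* the eight **atoms** `Kerr.sepAtom` (`∂₀²F, cos²θ ∂₀²F, ∂₁²F, ∂₁F, Δ̸F, ∂₁∂₃F, ∂₁∂₀F, ∂₀F`) and
  coefficients `Kerr.sepCoef r` with `sepRHS = ∑ sepCoef · sepAtom` (`sepRHS_eq_sum`), and the
  `𝓚`-valued form `angSlice W t r = ∑ sepCoef r i • angSlice (sepAtom i) t r` for `r > 0`
  (`angSlice_eq_sum_sepAtom`; the poles are a null set of the sphere);
* transport to frequency space at fixed `r` (`freqLp_eq_sum_sepAtom`, `ae_freq_eq_sum_sepAtom`),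
  the time rules `∂₀ ↦ 2πiξ` for the atoms (`ae_freq_atom_rules`) and the transported pair
  conditions (Laplacian: `ae_freq_laplacianPair`; azimuthal: `ae_freq_azimuthalPair`);
* **`Kerr.carter_frequency_identity`** (main): for `r > 0` and a.e. `ξ`, for every index `q`
  of the basis `Ψ_q = oblateSphereBasis (2π) (aω) q`, `ω = -2πξ`,
  `Δ ⟪Ψ_q, û₂⟫ + (2(r - M) + 2i(am - 2Mrω)) ⟪Ψ_q, û₁⟫ + (ω²(r² + 2Mr) - 2iMω - λ_q(aω)) ⟪Ψ_q, û⟫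
   = ⟪Ψ_q, ŵ⟫`, where `û, û₁, û₂, ŵ` are the values at `ξ` of the frequency classes of
  `F, ∂₁F, ∂₁²F, W` at radius `r` (`Δ = r² - 2Mr + a²`). The `cos²θ` terms of `ρ²∂_t²` and of
  `P(aω)` cancel, which is the point of the oblate spheroidal basis.

## References

* M. Dafermos, I. Rodnianski, Y. Shlapentokh-Rothman, arXiv:1402.7034, §5.2.2, Prop. 5.2.1.
  [DafermosRodnianskiShlapentokhrothman2014]
-/

noncomputable section

open Real Set Filter MeasureTheory Function
open scoped Topology ENNReal InnerProductSpace ComplexConjugate FourierTransform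

namespace Literature.Geometry.Lorentzian

namespace Kerr

open Literature.Analysis.SpecialFunctions Literature.Analysis.FunctionSpaces
  Literature.Analysis.Fourier

/-! ### The separated right-hand side in coordinate derivatives -/

/-- Coordinate second derivatives commute with `dir`: `∂_i(∂_j F) = D²F(e_i, e_j)`. [folklore] -/
theorem dir_dir_eq {F : E4 → ℝ} (hF : ContDiff ℝ 2 F) (i j : Fin 4) (q : E4) :
    dir i (dir j F) q = fderiv ℝ (fderiv ℝ F) q (E4.basisVector i) (E4.basisVector j) := by
  rw [dir_apply, show dir j F = fun q ↦ fderiv ℝ F q (E4.basisVector j) from rfl,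
    (hasFDerivAt_fderiv_apply hF q (E4.basisVector j)).fderiv, ContinuousLinearMap.flip_apply]

/-- **The separated right-hand side** of `Σ · (□Φ) ∘ κ_a` in the coordinates `(t*, r, θ, φ*)`:
`-(r² + a²cos²θ) ∂₀²F + (r² + a²) ∂₁²F + 2r ∂₁F + Δ̸F + 2a ∂₁∂₃F - 2Mr(∂₁²F - 2∂₁∂₀F + ∂₀²F)
 - 2M(∂₁F - ∂₀F)`, `F = Φ ∘ κ_a`. [cite: DafermosRodnianskiShlapentokhrothman2014, §5.2.3] -/
def sepRHS (a M : ℝ) (Φ : E4 → ℝ) (q : E4) : ℝ :=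
  -(q 1 ^ 2 + a ^ 2 * cos (q 2) ^ 2) * dir 0 (dir 0 (starPull a Φ)) q +
    (q 1 ^ 2 + a ^ 2) * dir 1 (dir 1 (starPull a Φ)) q + 2 * q 1 * dir 1 (starPull a Φ) q +
    sphLaplacianStar a Φ q + 2 * a * dir 1 (dir 3 (starPull a Φ)) q -
    2 * M * q 1 * (dir 1 (dir 1 (starPull a Φ)) q - 2 * dir 1 (dir 0 (starPull a Φ)) q +
      dir 0 (dir 0 (starPull a Φ)) q) -
    2 * M * (dir 1 (starPull a Φ) q - dir 0 (starPull a Φ) q)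

/-- **The coordinate wave operator** `g^{μν} ∂_μ∂_ν Φ + (∂_μ g^{μν}) ∂_ν Φ` in Kerr–Schild
Cartesian coordinates (`= □_g Φ` there, `det g = -1`). [cite: Aretakis2012, §2.4] -/
def coordWave (M a : ℝ) (Φ : E4 → ℝ) (y : E4) : ℝ :=
  ∑ μ, ∑ ν, inverseMetric M a y μ ν *
      fderiv ℝ (fderiv ℝ Φ) y (E4.basisVector μ) (E4.basisVector ν) +
    ∑ ν, divInverseMetric M a y ν * fderiv ℝ Φ y (E4.basisVector ν)

/-- **The tree's coordinate identity in the language of `dir`**: off the poles and for `r > 0`,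
`Σ · (coordWave Φ)(κ_a q) = sepRHS a M Φ q`. [cite: Aretakis2012, §2.4] -/
theorem sepRHS_eq_of_coordWave (a M : ℝ) {Φ : E4 → ℝ} (hΦ : ContDiff ℝ 2 Φ) {q : E4}
    (hr : 0 < q 1) (hθ : sin (q 2) ≠ 0) :
    (q 1 ^ 2 + a ^ 2 * cos (q 2) ^ 2) * coordWave M a Φ (starChart a q) = sepRHS a M Φ q := by
  have hF : ContDiff ℝ 2 (starPull a Φ) := hΦ.comp (contDiff_starChart a)
  have h := blSigma_mul_coordWave_starChart (a := a) M hr hθ hΦ.contDiffAt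
  rw [coordWave, h, sepRHS, sphLaplacianStar_eq hr hθ hΦ.contDiffAt]
  simp only [dir_dir_eq hF, dir_apply]
  ring

/-! ### Atoms and coefficients -/

/-- The eight **atoms** of the separated right-hand side:
`∂₀²F, cos²θ ∂₀²F, ∂₁²F, ∂₁F, Δ̸F, ∂₁∂₃F, ∂₁∂₀F, ∂₀F`. [folklore] -/
def sepAtom (a : ℝ) (Φ : E4 → ℝ) : Fin 8 → E4 → ℝ :=
  ![dir 0 (dir 0 (starPull a Φ)), cosSqMul (dir 0 (dir 0 (starPull a Φ))),
    dir 1 (dir 1 (starPull a Φ)), dir 1 (starPull a Φ), sphLaplacianStar a Φ,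
    dir 1 (dir 3 (starPull a Φ)), dir 1 (dir 0 (starPull a Φ)), dir 0 (starPull a Φ)]

/-- Their coefficients at radius `r`:
`-(r² + 2Mr), -a², r² + a² - 2Mr, 2(r - M), 1, 2a, 4Mr, 2M`. [folklore] -/
def sepCoef (a M r : ℝ) : Fin 8 → ℝ :=
  ![-(r ^ 2 + 2 * M * r), -a ^ 2, r ^ 2 + a ^ 2 - 2 * M * r, 2 * (r - M), 1, 2 * a, 4 * M * r,
    2 * M]

/-- `sepRHS = ∑ sepCoef · sepAtom` pointwise (with `r = q 1`). [folklore] -/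
theorem sepRHS_eq_sum (a M : ℝ) (Φ : E4 → ℝ) (q : E4) :
    sepRHS a M Φ q = ∑ i, sepCoef a M (q 1) i * sepAtom a Φ i q := by
  rw [Fin.sum_univ_eight]
  simp only [sepCoef, sepAtom, sepRHS, cosSqMul, Matrix.cons_val_zero, Matrix.cons_val_one,
    Matrix.cons_val]
  ring

/-- The atoms are continuous for `Φ ∈ C²`. [folklore] -/
theorem continuous_sepAtom (a : ℝ) {Φ : E4 → ℝ} (hΦ : ContDiff ℝ 2 Φ) (i : Fin 8) :
    Continuous (sepAtom a Φ i) := by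
  have hF : ContDiff ℝ 2 (starPull a Φ) := hΦ.comp (contDiff_starChart a)
  have h1 : ∀ j, ContDiff ℝ 1 (dir j (starPull a Φ)) := fun j ↦ contDiff_one_dir hF j
  have h2 : ∀ i j, Continuous (dir i (dir j (starPull a Φ))) := fun i j ↦
    continuous_dir (h1 j) one_ne_zero i
  fin_cases i
  · exact h2 0 0
  · exact continuous_cosSqMul (h2 0 0)
  · exact h2 1 1
  · exact (h1 1).continuous
  · exact continuous_sphLaplacianStar a hΦ
  · exact h2 1 3
  · exact h2 1 0
  · exact (h1 0).continuous

/-! ### The identity in `𝓚` at each `(t, r)`, `r > 0` -/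

section KLevel

variable [h2π : Fact (0 < 2 * π)]

/-- The first coordinate is a.e. in the *open* interval `(-1, 1)` (the poles are null).
[folklore] -/
theorem ae_fst_mem_Ioo : ∀ᵐ z ∂sphereMeasure (2 * π), z.1 ∈ Ioo (-1 : ℝ) 1 := by
  have h1 : ∀ᵐ x ∂legendreMeasure, x ∈ Ioo (-1 : ℝ) 1 := by
    have hne1 : ∀ᵐ x ∂legendreMeasure, x ≠ 1 :=
      ae_restrict_of_ae (compl_mem_ae_iff.2 (measure_singleton (1 : ℝ)))
    have hne2 : ∀ᵐ x ∂legendreMeasure, x ≠ -1 :=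
      ae_restrict_of_ae (compl_mem_ae_iff.2 (measure_singleton (-1 : ℝ)))
    filter_upwards [ae_legendreMeasure_of_forall_mem (p := fun x ↦ x ∈ Icc (-1 : ℝ) 1)
      fun _ hx ↦ hx, hne1, hne2] with x hx h1 h2
    exact ⟨lt_of_le_of_ne hx.1 (Ne.symm h2), lt_of_le_of_ne hx.2 h1⟩
  exact (Measure.quasiMeasurePreserving_fst (μ := legendreMeasure)
    (ν := (AddCircle.haarAddCircle : Measure (AddCircle (2 * π))))).ae h1

omit h2π in
/-- `sin (arccos x) ≠ 0` for `x ∈ (-1, 1)`. [folklore] -/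
theorem sin_arccos_ne_zero {x : ℝ} (hx : x ∈ Ioo (-1 : ℝ) 1) : sin (arccos x) ≠ 0 := by
  rw [Real.sin_arccos]
  have : 0 < 1 - x ^ 2 := by nlinarith [hx.1, hx.2]
  positivity

omit h2π in
/-- a.e. form of a finite linear combination in `Lp`. [folklore] -/
theorem coeFn_sum_smul {X : Type*} [MeasurableSpace X] {μ : Measure X} {E : Type*}
    [NormedAddCommGroup E] [NormedSpace ℂ E] {ι : Type*} (s : Finset ι) (c : ι → ℂ)
    (f : ι → Lp E 2 μ) :
    ((∑ i ∈ s, c i • f i : Lp E 2 μ) : X → E) =ᵐ[μ] fun x ↦ ∑ i ∈ s, c i • (f i : X → E) x := by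
  classical
  induction s using Finset.induction_on with
  | empty =>
    rw [Finset.sum_empty]
    filter_upwards [Lp.coeFn_zero E 2 μ] with x hx
    rw [hx, Finset.sum_empty]
    rfl
  | insert a s ha ih =>
    rw [Finset.sum_insert ha]
    filter_upwards [Lp.coeFn_add (c a • f a) (∑ i ∈ s, c i • f i), Lp.coeFn_smul (c a) (f a), ih]
      with x h1 h2 h3
    rw [h1, Pi.add_apply, h2, Pi.smul_apply, h3, Finset.sum_insert ha]

/-- **The separated identity in `𝓚`**: for a continuous `W` equal to `sepRHS a M Φ` off the poles
on `{r > 0}`, and `r > 0`,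
`angSlice W t r = ∑ i, sepCoef r i • angSlice (sepAtom i) t r`. [folklore] -/
theorem angSlice_eq_sum_sepAtom (a M : ℝ) {Φ : E4 → ℝ} (hΦ : ContDiff ℝ 2 Φ) {W : E4 → ℝ}
    (hWc : Continuous W) (hW : ∀ q : E4, 0 < q 1 → sin (q 2) ≠ 0 → W q = sepRHS a M Φ q)
    (t : ℝ) {r : ℝ} (hr : 0 < r) :
    angSlice W hWc t r =
      ∑ i, (sepCoef a M r i : ℂ) • angSlice (sepAtom a Φ i) (continuous_sepAtom a hΦ i) t r := by
  refine Lp.ext ?_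
  have hall : ∀ i, (angSlice (sepAtom a Φ i) (continuous_sepAtom a hΦ i) t r :
      ℝ × AddCircle (2 * π) → ℂ) =ᵐ[sphereMeasure (2 * π)]
        polarFn (2 * π) (coordSlice (sepAtom a Φ i) t r) := fun i ↦ coeFn_polarLp (2 * π) _ _
  have hall' := ae_all_iff.2 hall
  filter_upwards [coeFn_polarLp (2 * π) _ (continuous_coordSlice hWc t r),
    coeFn_sum_smul Finset.univ (fun i ↦ (sepCoef a M r i : ℂ))
      (fun i ↦ angSlice (sepAtom a Φ i) (continuous_sepAtom a hΦ i) t r), hall',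
    ae_fst_mem_Ioo] with z h0 h1 h2 hz
  rw [angSlice_def, h0, h1]
  simp only [h2, polarFn_coordSlice]
  have hq1 : 0 < (starq t r (arccos z.1) ((AddCircle.equivIco (2 * π) 0 z.2 : ℝ))) 1 := by
    rwa [starq_apply_one]
  have hq2 : sin ((starq t r (arccos z.1) ((AddCircle.equivIco (2 * π) 0 z.2 : ℝ))) 2) ≠ 0 := by
    rw [starq_apply_two]
    exact sin_arccos_ne_zero hz
  rw [hW _ hq1 hq2, sepRHS_eq_sum, starq_apply_one]
  push_cast
  rfl

end KLevel

/-! ### Transport to frequency space at fixed `r` -/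

section Freq

variable [h2π : Fact (0 < 2 * π)]

omit h2π in
/-- Symmetry of mixed coordinate derivatives for `F ∈ C²`. [folklore] -/
theorem dir_comm {F : E4 → ℝ} (hF : ContDiff ℝ 2 F) (i j : Fin 4) :
    dir i (dir j F) = dir j (dir i F) := by
  funext q
  rw [dir_dir_eq hF, dir_dir_eq hF]
  exact (hF.contDiffAt.isSymmSndFDerivAt (by simp)).eq _ _

/-- **The separated identity in `𝓗 = L²(ℝ; 𝓚)`** at radius `r > 0`. [folklore] -/
theorem timeLp_eq_sum_sepAtom (a M : ℝ) {Φ : E4 → ℝ} (hΦ : ContDiff ℝ 2 Φ) {W : E4 → ℝ}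
    (hWc : Continuous W) (hW : ∀ q : E4, 0 < q 1 → sin (q 2) ≠ 0 → W q = sepRHS a M Φ q)
    (hIW : ∀ r, TimeSqInt W hWc r)
    (hIA : ∀ i r, TimeSqInt (sepAtom a Φ i) (continuous_sepAtom a hΦ i) r) {r : ℝ} (hr : 0 < r) :
    timeLp W hWc hIW r =
      ∑ i, (sepCoef a M r i : ℂ) •
        timeLp (sepAtom a Φ i) (continuous_sepAtom a hΦ i) (hIA i) r := by
  refine Lp.ext ?_
  filter_upwards [coeFn_timeLp W hWc hIW r, coeFn_sum_smul Finset.univ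
    (fun i ↦ (sepCoef a M r i : ℂ)) (fun i ↦ timeLp (sepAtom a Φ i) (continuous_sepAtom a hΦ i)
      (hIA i) r), ae_all_iff.2 fun i ↦ coeFn_timeLp (sepAtom a Φ i) (continuous_sepAtom a hΦ i)
      (hIA i) r] with t h0 h1 h2
  rw [h0, h1, angSlice_eq_sum_sepAtom a M hΦ hWc hW t hr]
  exact Finset.sum_congr rfl fun i _ ↦ by rw [h2 i]

/-- **The separated identity in frequency space** at radius `r > 0`. [folklore] -/
theorem freqLp_eq_sum_sepAtom (a M : ℝ) {Φ : E4 → ℝ} (hΦ : ContDiff ℝ 2 Φ) {W : E4 → ℝ}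
    (hWc : Continuous W) (hW : ∀ q : E4, 0 < q 1 → sin (q 2) ≠ 0 → W q = sepRHS a M Φ q)
    (hIW : ∀ r, TimeSqInt W hWc r)
    (hIA : ∀ i r, TimeSqInt (sepAtom a Φ i) (continuous_sepAtom a hΦ i) r) {r : ℝ} (hr : 0 < r) :
    freqLp W hWc hIW r =
      ∑ i, (sepCoef a M r i : ℂ) •
        freqLp (sepAtom a Φ i) (continuous_sepAtom a hΦ i) (hIA i) r := by
  simp only [freqLp_def, timeLp_eq_sum_sepAtom a M hΦ hWc hW hIW hIA hr]
  change (Lp.fourierTransformₗᵢ ℝ AngSpace) (∑ i, _ • _) =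
    ∑ i, _ • (Lp.fourierTransformₗᵢ ℝ AngSpace) _
  rw [map_sum]
  exact Finset.sum_congr rfl fun i _ ↦ by rw [map_smul]

/-- Its a.e. form on representatives. [folklore] -/
theorem ae_freq_eq_sum_sepAtom (a M : ℝ) {Φ : E4 → ℝ} (hΦ : ContDiff ℝ 2 Φ) {W : E4 → ℝ}
    (hWc : Continuous W) (hW : ∀ q : E4, 0 < q 1 → sin (q 2) ≠ 0 → W q = sepRHS a M Φ q)
    (hIW : ∀ r, TimeSqInt W hWc r)
    (hIA : ∀ i r, TimeSqInt (sepAtom a Φ i) (continuous_sepAtom a hΦ i) r) {r : ℝ} (hr : 0 < r) :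
    ∀ᵐ ξ ∂volume, (freqLp W hWc hIW r : ℝ → AngSpace) ξ =
      ∑ i, (sepCoef a M r i : ℂ) •
        (freqLp (sepAtom a Φ i) (continuous_sepAtom a hΦ i) (hIA i) r : ℝ → AngSpace) ξ := by
  rw [freqLp_eq_sum_sepAtom a M hΦ hWc hW hIW hIA hr]
  exact coeFn_sum_smul _ _ _

/-- **Transport of a pair condition**: if `A (angSlice H₁ t r) = B (angSlice H₂ t r)` for all
`t`, for continuous linear `A, B : 𝓚 → ℂ`, then `A (ĥ₁(ξ)) = B (ĥ₂(ξ))` for a.e. `ξ`.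
[folklore] -/
theorem ae_freq_pair {H₁ H₂ : E4 → ℝ} (h₁c : Continuous H₁) (h₂c : Continuous H₂)
    (hI₁ : ∀ r, TimeSqInt H₁ h₁c r) (hI₂ : ∀ r, TimeSqInt H₂ h₂c r) (A B : AngSpace →L[ℂ] ℂ)
    {r : ℝ} (hpt : ∀ t, A (angSlice H₁ h₁c t r) = B (angSlice H₂ h₂c t r)) :
    ∀ᵐ ξ ∂volume, A ((freqLp H₁ h₁c hI₁ r : ℝ → AngSpace) ξ) =
      B ((freqLp H₂ h₂c hI₂ r : ℝ → AngSpace) ξ) := by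
  have htime : A.compLp (timeLp H₁ h₁c hI₁ r) = B.compLp (timeLp H₂ h₂c hI₂ r) := by
    refine Lp.ext ?_
    filter_upwards [A.coeFn_compLp (timeLp H₁ h₁c hI₁ r), B.coeFn_compLp (timeLp H₂ h₂c hI₂ r),
      coeFn_timeLp H₁ h₁c hI₁ r, coeFn_timeLp H₂ h₂c hI₂ r] with t h1 h2 h3 h4
    rw [h1, h2, h3, h4, hpt]
  have hfreq : A.compLp (freqLp H₁ h₁c hI₁ r) = B.compLp (freqLp H₂ h₂c hI₂ r) := by
    rw [freqLp_def, freqLp_def, ← fourier_compLp_eq, ← fourier_compLp_eq, htime]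
  filter_upwards [A.coeFn_compLp (freqLp H₁ h₁c hI₁ r), B.coeFn_compLp (freqLp H₂ h₂c hI₂ r),
    EventuallyEq.of_eq (congrArg (fun f : Lp ℂ 2 (volume : Measure ℝ) ↦ (f : ℝ → ℂ)) hfreq)]
    with ξ h1 h2 h3
  rw [← h1, ← h2]
  exact h3

end Freq

/-! ### Time rules and pair conditions for the atoms (fixed `r`, a.e. `ξ`) -/

section Rules

variable [h2π : Fact (0 < 2 * π)]

/-- `freqLp` does not depend on the way its function argument is written. [folklore] -/
theorem freqLp_congr {G₁ G₂ : E4 → ℝ} (h : G₁ = G₂) (c₁ : Continuous G₁) (c₂ : Continuous G₂)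
    (I₁ : ∀ r, TimeSqInt G₁ c₁ r) (I₂ : ∀ r, TimeSqInt G₂ c₂ r) (r : ℝ) :
    freqLp G₁ c₁ I₁ r = freqLp G₂ c₂ I₂ r := by
  subst h
  rfl

variable (a : ℝ) {Φ : E4 → ℝ}

omit h2π in
/-- `F = Φ ∘ κ_a ∈ C²`. [folklore] -/
theorem contDiff_two_starPull (hΦ : ContDiff ℝ 2 Φ) : ContDiff ℝ 2 (starPull a Φ) :=
  hΦ.comp (contDiff_starChart a)

omit h2π in
/-- `F ∈ C¹`. [folklore] -/
theorem contDiff_one_starPull (hΦ : ContDiff ℝ 2 Φ) : ContDiff ℝ 1 (starPull a Φ) :=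
  (contDiff_two_starPull a hΦ).of_le one_le_two

omit h2π in
/-- `∂₁F` is `2π`-periodic in `φ*`. [folklore] -/
theorem dir_one_starPull_add_two_pi (Φ : E4 → ℝ) (q : E4) :
    dir 1 (starPull a Φ) (q + (2 * π) • E4.basisVector 3) = dir 1 (starPull a Φ) q := by
  rw [dir_apply, dir_apply, fderiv_starPull_add_two_pi]

/-- **Rule for `∂₀F`**: `(∂₀F)^(ξ) = (2πiξ) û(ξ)` a.e. [folklore] -/
theorem ae_rule_dir0 (hΦ : ContDiff ℝ 2 Φ)
    (hIF : ∀ r, TimeSqInt (starPull a Φ) (contDiff_two_starPull a hΦ).continuous r)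
    (hI0 : ∀ r, TimeSqInt (dir 0 (starPull a Φ))
      (continuous_dir (contDiff_one_starPull a hΦ) one_ne_zero 0) r) (r : ℝ) :
    ∀ᵐ ξ ∂volume, (freqLp (dir 0 (starPull a Φ))
        (continuous_dir (contDiff_one_starPull a hΦ) one_ne_zero 0) hI0 r : ℝ → AngSpace) ξ =
      ((2 * π * Complex.I) * ξ : ℂ) •
        (freqLp (starPull a Φ) (contDiff_two_starPull a hΦ).continuous hIF r : ℝ → AngSpace) ξ :=
  freqLp_dir0_ae_eq (contDiff_one_starPull a hΦ) hIF hI0 r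

/-- **Rule for `∂₀²F`**: `(∂₀²F)^(ξ) = (2πiξ)² û(ξ)` a.e. [folklore] -/
theorem ae_rule_dir00 (hΦ : ContDiff ℝ 2 Φ)
    (hIF : ∀ r, TimeSqInt (starPull a Φ) (contDiff_two_starPull a hΦ).continuous r)
    (hI0 : ∀ r, TimeSqInt (dir 0 (starPull a Φ))
      (continuous_dir (contDiff_one_starPull a hΦ) one_ne_zero 0) r)
    (hI00 : ∀ r, TimeSqInt (dir 0 (dir 0 (starPull a Φ)))
      (continuous_dir (contDiff_one_dir (contDiff_two_starPull a hΦ) 0) one_ne_zero 0) r) (r : ℝ) :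
    ∀ᵐ ξ ∂volume, (freqLp (dir 0 (dir 0 (starPull a Φ)))
        (continuous_dir (contDiff_one_dir (contDiff_two_starPull a hΦ) 0) one_ne_zero 0) hI00 r :
          ℝ → AngSpace) ξ =
      ((2 * π * Complex.I) * ξ : ℂ) • ((2 * π * Complex.I) * ξ : ℂ) •
        (freqLp (starPull a Φ) (contDiff_two_starPull a hΦ).continuous hIF r : ℝ → AngSpace) ξ := by
  filter_upwards [freqLp_dir0_ae_eq (contDiff_one_dir (contDiff_two_starPull a hΦ) 0) hI0 hI00 r,
    ae_rule_dir0 a hΦ hIF hI0 r] with ξ h1 h2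
  rw [h1, h2]

/-- **Rule for `∂₁∂₀F`**: `(∂₁∂₀F)^(ξ) = (2πiξ) û₁(ξ)` a.e. (`∂₁∂₀ = ∂₀∂₁`). [folklore] -/
theorem ae_rule_dir10 (hΦ : ContDiff ℝ 2 Φ)
    (hI1 : ∀ r, TimeSqInt (dir 1 (starPull a Φ))
      (continuous_dir (contDiff_one_starPull a hΦ) one_ne_zero 1) r)
    (hI10 : ∀ r, TimeSqInt (dir 1 (dir 0 (starPull a Φ)))
      (continuous_dir (contDiff_one_dir (contDiff_two_starPull a hΦ) 0) one_ne_zero 1) r) (r : ℝ) :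
    ∀ᵐ ξ ∂volume, (freqLp (dir 1 (dir 0 (starPull a Φ)))
        (continuous_dir (contDiff_one_dir (contDiff_two_starPull a hΦ) 0) one_ne_zero 1) hI10 r :
          ℝ → AngSpace) ξ =
      ((2 * π * Complex.I) * ξ : ℂ) • (freqLp (dir 1 (starPull a Φ))
        (continuous_dir (contDiff_one_starPull a hΦ) one_ne_zero 1) hI1 r : ℝ → AngSpace) ξ := by
  have hsymm : dir 1 (dir 0 (starPull a Φ)) = dir 0 (dir 1 (starPull a Φ)) :=
    dir_comm (contDiff_two_starPull a hΦ) 1 0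
  have hc' : Continuous (dir 0 (dir 1 (starPull a Φ))) :=
    continuous_dir (contDiff_one_dir (contDiff_two_starPull a hΦ) 1) one_ne_zero 0
  have hI' : ∀ r, TimeSqInt (dir 0 (dir 1 (starPull a Φ))) hc' r := by
    intro r'
    have := hI10 r'
    unfold TimeSqInt at this ⊢
    convert this using 3; simp [hsymm]
  rw [freqLp_congr hsymm _ hc' hI10 hI' r]
  exact freqLp_dir0_ae_eq (contDiff_one_dir (contDiff_two_starPull a hΦ) 1) hI1 hI' r

/-- **Rule for `cos²θ ∂₀²F`**: `(cos²θ ∂₀²F)^(ξ) = (2πiξ)² x² û(ξ)` a.e. [folklore] -/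
theorem ae_rule_cosSq (hΦ : ContDiff ℝ 2 Φ)
    (hIF : ∀ r, TimeSqInt (starPull a Φ) (contDiff_two_starPull a hΦ).continuous r)
    (hI0 : ∀ r, TimeSqInt (dir 0 (starPull a Φ))
      (continuous_dir (contDiff_one_starPull a hΦ) one_ne_zero 0) r)
    (hI00 : ∀ r, TimeSqInt (dir 0 (dir 0 (starPull a Φ)))
      (continuous_dir (contDiff_one_dir (contDiff_two_starPull a hΦ) 0) one_ne_zero 0) r)
    (hIc : ∀ r, TimeSqInt (cosSqMul (dir 0 (dir 0 (starPull a Φ))))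
      (continuous_cosSqMul
        (continuous_dir (contDiff_one_dir (contDiff_two_starPull a hΦ) 0) one_ne_zero 0)) r)
    (r : ℝ) :
    ∀ᵐ ξ ∂volume, (freqLp (cosSqMul (dir 0 (dir 0 (starPull a Φ))))
        (continuous_cosSqMul
          (continuous_dir (contDiff_one_dir (contDiff_two_starPull a hΦ) 0) one_ne_zero 0)) hIc r :
          ℝ → AngSpace) ξ =
      ((2 * π * Complex.I) * ξ : ℂ) • ((2 * π * Complex.I) * ξ : ℂ) •
        mulSqFst (2 * π) ((freqLp (starPull a Φ) (contDiff_two_starPull a hΦ).continuous hIF r :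
          ℝ → AngSpace) ξ) := by
  filter_upwards [freqLp_cosSqMul_ae_eq
    (continuous_dir (contDiff_one_dir (contDiff_two_starPull a hΦ) 0) one_ne_zero 0) hI00 hIc r,
    ae_rule_dir00 a hΦ hIF hI0 hI00 r] with ξ h1 h2
  rw [h1, h2, map_smul, map_smul]

/-- **The transported Laplacian pair condition**: for a.e. `ξ` and all `(m, k)`,
`⟪Y_{m,k}, (Δ̸F)^(ξ)⟫ = -Λ_{|m|,k} ⟪Y_{m,k}, û(ξ)⟫` (`r > 0`). [folklore] -/
theorem ae_laplacianPair (hΦ : ContDiff ℝ 2 Φ)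
    (hIF : ∀ r, TimeSqInt (starPull a Φ) (contDiff_two_starPull a hΦ).continuous r)
    (hIS : ∀ r, TimeSqInt (sphLaplacianStar a Φ) (continuous_sphLaplacianStar a hΦ) r) {r : ℝ}
    (hr : 0 < r) :
    ∀ᵐ ξ ∂volume, ∀ mk : ℤ × ℕ,
      ⟪sphHarmTensor (2 * π) mk.1 mk.2, (freqLp (sphLaplacianStar a Φ)
        (continuous_sphLaplacianStar a hΦ) hIS r : ℝ → AngSpace) ξ⟫_ℂ =
      -(assocLegLevel mk.1.natAbs mk.2 : ℂ) * ⟪sphHarmTensor (2 * π) mk.1 mk.2,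
        (freqLp (starPull a Φ) (contDiff_two_starPull a hΦ).continuous hIF r :
          ℝ → AngSpace) ξ⟫_ℂ := by
  refine ae_all_iff.2 fun mk ↦ ?_
  have h := ae_freq_pair (continuous_sphLaplacianStar a hΦ) (contDiff_two_starPull a hΦ).continuous
    hIS hIF (innerSL ℂ (sphHarmTensor (2 * π) mk.1 mk.2))
    ((-(assocLegLevel mk.1.natAbs mk.2 : ℂ)) • innerSL ℂ (sphHarmTensor (2 * π) mk.1 mk.2))
    (r := r) fun t ↦ by
      rw [_root_.smul_apply, innerSL_apply_apply, innerSL_apply_apply, smul_eq_mul]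
      exact inner_sphHarmTensor_angSlice_sphLaplacianStar a hΦ hr mk.1 mk.2
  filter_upwards [h] with ξ hξ
  rw [_root_.smul_apply, innerSL_apply_apply, innerSL_apply_apply, smul_eq_mul] at hξ
  exact hξ

/-- **The transported azimuthal pair condition**: for a.e. `ξ` and all `(m, k)`,
`⟪Y_{m,k}, (∂₁∂₃F)^(ξ)⟫ = (im) ⟪Y_{m,k}, û₁(ξ)⟫`. [folklore] -/
theorem ae_azimuthalPair (hΦ : ContDiff ℝ 2 Φ)
    (hI1 : ∀ r, TimeSqInt (dir 1 (starPull a Φ))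
      (continuous_dir (contDiff_one_starPull a hΦ) one_ne_zero 1) r)
    (hI13 : ∀ r, TimeSqInt (dir 1 (dir 3 (starPull a Φ)))
      (continuous_dir (contDiff_one_dir (contDiff_two_starPull a hΦ) 3) one_ne_zero 1) r) (r : ℝ) :
    ∀ᵐ ξ ∂volume, ∀ mk : ℤ × ℕ,
      ⟪sphHarmTensor (2 * π) mk.1 mk.2, (freqLp (dir 1 (dir 3 (starPull a Φ)))
        (continuous_dir (contDiff_one_dir (contDiff_two_starPull a hΦ) 3) one_ne_zero 1) hI13 r :
          ℝ → AngSpace) ξ⟫_ℂ =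
      (Complex.I * mk.1) * ⟪sphHarmTensor (2 * π) mk.1 mk.2, (freqLp (dir 1 (starPull a Φ))
        (continuous_dir (contDiff_one_starPull a hΦ) one_ne_zero 1) hI1 r : ℝ → AngSpace) ξ⟫_ℂ := by
  have hF2 := contDiff_two_starPull a hΦ
  have hsymm : dir 1 (dir 3 (starPull a Φ)) = dir 3 (dir 1 (starPull a Φ)) := dir_comm hF2 1 3
  have hc' : Continuous (dir 3 (dir 1 (starPull a Φ))) :=
    continuous_dir (contDiff_one_dir hF2 1) one_ne_zero 3
  have hI' : ∀ r, TimeSqInt (dir 3 (dir 1 (starPull a Φ))) hc' r := by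
    intro r'
    have := hI13 r'
    unfold TimeSqInt at this ⊢
    convert this using 3; simp [hsymm]
  rw [freqLp_congr hsymm _ hc' hI13 hI' r]
  refine ae_all_iff.2 fun mk ↦ ?_
  have h1d : ContDiff ℝ 1 (dir 1 (starPull a Φ)) := contDiff_one_dir hF2 1
  have hpt : ∀ t,
      ⟪sphHarmTensor (2 * π) mk.1 mk.2, angSlice (dir 3 (dir 1 (starPull a Φ))) hc' t r⟫_ℂ =
      (Complex.I * mk.1) * ⟪sphHarmTensor (2 * π) mk.1 mk.2,
        angSlice (dir 1 (starPull a Φ)) h1d.continuous t r⟫_ℂ := by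
    intro t
    rw [sphHarmTensor, angSlice_def, angSlice_def,
      inner_tensorLp_fourierLp_polarLp_deriv _ mk.1 (continuous_coordSlice h1d.continuous t r)
        (continuous_coordSlice hc' t r)]
    · congr 1
      have hπ : (π : ℂ) ≠ 0 := by exact_mod_cast pi_ne_zero
      field_simp
      push_cast
      ring
    · intro θ φ
      simp only [coordSlice_apply, dir_apply (i := 3)]
      exact (hasDerivAt_comp_starq_phi t r θ φ (h1d.differentiable one_ne_zero _)).ofReal_comp
    · intro θ
      simp only [coordSlice_apply]
      rw [show (2 * π : ℝ) = 0 + 2 * π by ring, starq_add_phi, dir_one_starPull_add_two_pi]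
  have h := ae_freq_pair hc' h1d.continuous hI' hI1 (innerSL ℂ (sphHarmTensor (2 * π) mk.1 mk.2))
    ((Complex.I * mk.1) • innerSL ℂ (sphHarmTensor (2 * π) mk.1 mk.2)) (r := r) fun t ↦ by
      rw [_root_.smul_apply, innerSL_apply_apply, innerSL_apply_apply, smul_eq_mul]
      exact hpt t
  filter_upwards [h] with ξ hξ
  rw [_root_.smul_apply, innerSL_apply_apply, innerSL_apply_apply, smul_eq_mul] at hξ
  exact hξ

end Rules

/-! ### The identity paired with the oblate spheroidal basis at the frequency at hand -/

section Main

variable [h2π : Fact (0 < 2 * π)]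

/-- Inner product with a finite linear combination. [folklore] -/
theorem inner_sum_smul_right {ι : Type*} (s : Finset ι) (c : ι → ℂ) (v : ι → AngSpace)
    (w : AngSpace) : ⟪w, ∑ i ∈ s, c i • v i⟫_ℂ = ∑ i ∈ s, c i * ⟪w, v i⟫_ℂ := by
  rw [inner_sum]
  exact Finset.sum_congr rfl fun i _ ↦ inner_smul_right _ _ _

/-- **Carter's separation at fixed `r` for a.e. frequency** (DRSR Prop. 5.2.1, frequency-space
form in the coordinates `(t*, r, θ, φ*)`). Let `Φ ∈ C²(ℝ⁴)`, `F = Φ ∘ κ_a`, let `W` be continuous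
and equal to the separated right-hand side `sepRHS a M Φ` off the poles on `{r > 0}` (e.g.
`W = Σ · (□Φ) ∘ κ_a`, `sepRHS_eq_of_coordWave`), and assume time square-integrability of the
slices of `F, ∂₀F, ∂₁F, W` and of the eight atoms at every radius. Fix `r > 0`. Then for a.e. `ξ`,
with `ω = -2πξ`, `ν = aω`, for every index `q` (`m = q.1`) of `Ψ_q = oblateSphereBasis (2π) ν q`:
`Δ ⟪Ψ_q, û₂⟫ + (2(r - M) + 2i(am - 2Mrω)) ⟪Ψ_q, û₁⟫ + (ω²(r² + 2Mr) - 2iMω - λ_q(ν)) ⟪Ψ_q, û⟫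
 = ⟪Ψ_q, ŵ⟫`, where `û, û₁, û₂, ŵ` are the values at `ξ` of `freqLp` of `F, ∂₁F, ∂₁²F, W` at
radius `r` and `Δ = r² - 2Mr + a²`. [cite: DafermosRodnianskiShlapentokhrothman2014, Prop. 5.2.1] -/
theorem carter_frequency_identity (a M : ℝ) {Φ : E4 → ℝ} (hΦ : ContDiff ℝ 2 Φ) {W : E4 → ℝ}
    (hWc : Continuous W) (hW : ∀ q : E4, 0 < q 1 → sin (q 2) ≠ 0 → W q = sepRHS a M Φ q)
    (hIW : ∀ r, TimeSqInt W hWc r)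
    (hIF : ∀ r, TimeSqInt (starPull a Φ) (contDiff_two_starPull a hΦ).continuous r)
    (hI0 : ∀ r, TimeSqInt (dir 0 (starPull a Φ))
      (continuous_dir (contDiff_one_starPull a hΦ) one_ne_zero 0) r)
    (hI1 : ∀ r, TimeSqInt (dir 1 (starPull a Φ))
      (continuous_dir (contDiff_one_starPull a hΦ) one_ne_zero 1) r)
    (hIA : ∀ i r, TimeSqInt (sepAtom a Φ i) (continuous_sepAtom a hΦ i) r)
    {r : ℝ} (hr : 0 < r) :
    ∀ᵐ ξ ∂volume, ∀ q : OblateSphereIndex (a * (-2 * π * ξ)),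
      ((r ^ 2 - 2 * M * r + a ^ 2 : ℝ) : ℂ) *
          ⟪oblateSphereBasis (2 * π) (a * (-2 * π * ξ)) q,
            (freqLp (sepAtom a Φ 2) (continuous_sepAtom a hΦ 2) (hIA 2) r : ℝ → AngSpace) ξ⟫_ℂ +
        ((2 * (r - M) : ℝ) + 2 * Complex.I * (a * q.1 - 2 * M * r * (-2 * π * ξ))) *
          ⟪oblateSphereBasis (2 * π) (a * (-2 * π * ξ)) q,
            (freqLp (dir 1 (starPull a Φ))
              (continuous_dir (contDiff_one_starPull a hΦ) one_ne_zero 1) hI1 r :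
                ℝ → AngSpace) ξ⟫_ℂ +
        (((-2 * π * ξ) ^ 2 * (r ^ 2 + 2 * M * r) : ℝ) - 2 * Complex.I * M * (-2 * π * ξ) -
            (oblateSphereEig (a * (-2 * π * ξ)) q : ℂ)) *
          ⟪oblateSphereBasis (2 * π) (a * (-2 * π * ξ)) q,
            (freqLp (starPull a Φ) (contDiff_two_starPull a hΦ).continuous hIF r :
              ℝ → AngSpace) ξ⟫_ℂ =
      ⟪oblateSphereBasis (2 * π) (a * (-2 * π * ξ)) q,
        (freqLp W hWc hIW r : ℝ → AngSpace) ξ⟫_ℂ := by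
  -- the atom integrabilities in explicit form (definitional unfoldings of `sepAtom`)
  have hI00 : ∀ r, TimeSqInt (dir 0 (dir 0 (starPull a Φ)))
      (continuous_dir (contDiff_one_dir (contDiff_two_starPull a hΦ) 0) one_ne_zero 0) r := hIA 0
  have hIc : ∀ r, TimeSqInt (cosSqMul (dir 0 (dir 0 (starPull a Φ))))
      (continuous_cosSqMul
        (continuous_dir (contDiff_one_dir (contDiff_two_starPull a hΦ) 0) one_ne_zero 0)) r := hIA 1
  have hIS : ∀ r, TimeSqInt (sphLaplacianStar a Φ) (continuous_sphLaplacianStar a hΦ) r := hIA 4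
  have hI13 : ∀ r, TimeSqInt (dir 1 (dir 3 (starPull a Φ)))
      (continuous_dir (contDiff_one_dir (contDiff_two_starPull a hΦ) 3) one_ne_zero 1) r := hIA 5
  have hI10 : ∀ r, TimeSqInt (dir 1 (dir 0 (starPull a Φ)))
      (continuous_dir (contDiff_one_dir (contDiff_two_starPull a hΦ) 0) one_ne_zero 1) r := hIA 6
  filter_upwards [ae_freq_eq_sum_sepAtom a M hΦ hWc hW hIW hIA hr, ae_rule_dir0 a hΦ hIF hI0 r,
    ae_rule_dir00 a hΦ hIF hI0 hI00 r, ae_rule_dir10 a hΦ hI1 hI10 r,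
    ae_rule_cosSq a hΦ hIF hI0 hI00 hIc r, ae_laplacianPair a hΦ hIF hIS hr,
    ae_azimuthalPair a hΦ hI1 hI13 r] with ξ hsum h7 h0 h6 h1 hPL hPA
  intro q
  -- notation
  set z : ℂ := (2 * π * Complex.I) * ξ with hz
  set u : AngSpace := (freqLp (starPull a Φ) (contDiff_two_starPull a hΦ).continuous hIF r :
    ℝ → AngSpace) ξ with hu
  set u₁ : AngSpace := (freqLp (dir 1 (starPull a Φ))
    (continuous_dir (contDiff_one_starPull a hΦ) one_ne_zero 1) hI1 r : ℝ → AngSpace) ξ with hu₁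
  -- the paired identity, atom by atom
  rw [hsum, inner_sum_smul_right, Fin.sum_univ_eight]
  -- atoms 7, 0, 6, 1, 3 by the time rules / definitions
  have e7 : (freqLp (sepAtom a Φ 7) (continuous_sepAtom a hΦ 7) (hIA 7) r : ℝ → AngSpace) ξ =
      z • u := h7
  have e0 : (freqLp (sepAtom a Φ 0) (continuous_sepAtom a hΦ 0) (hIA 0) r : ℝ → AngSpace) ξ =
      z • z • u := h0
  have e6 : (freqLp (sepAtom a Φ 6) (continuous_sepAtom a hΦ 6) (hIA 6) r : ℝ → AngSpace) ξ =
      z • u₁ := h6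
  have e1 : (freqLp (sepAtom a Φ 1) (continuous_sepAtom a hΦ 1) (hIA 1) r : ℝ → AngSpace) ξ =
      z • z • mulSqFst (2 * π) u := h1
  have e3 : (freqLp (sepAtom a Φ 3) (continuous_sepAtom a hΦ 3) (hIA 3) r : ℝ → AngSpace) ξ =
      u₁ := rfl
  -- atom 4: the weak eigen-equation against the transported Laplacian pair
  have e4 : ⟪oblateSphereBasis (2 * π) (a * (-2 * π * ξ)) q,
      (freqLp (sepAtom a Φ 4) (continuous_sepAtom a hΦ 4) (hIA 4) r : ℝ → AngSpace) ξ⟫_ℂ =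
      -(oblateSphereEig (a * (-2 * π * ξ)) q : ℂ) *
          ⟪oblateSphereBasis (2 * π) (a * (-2 * π * ξ)) q, u⟫_ℂ -
        (((a * (-2 * π * ξ)) ^ 2 : ℝ) : ℂ) *
          ⟪oblateSphereBasis (2 * π) (a * (-2 * π * ξ)) q, mulSqFst (2 * π) u⟫_ℂ := by
    have hw := oblateSphere_weak_of_pair (T := 2 * π) (a * (-2 * π * ξ)) q u
      (-(freqLp (sepAtom a Φ 4) (continuous_sepAtom a hΦ 4) (hIA 4) r : ℝ → AngSpace) ξ)
      fun m k ↦ by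
        rw [inner_neg_right]
        have hmk := hPL (m, k)
        rw [show (freqLp (sphLaplacianStar a Φ) (continuous_sphLaplacianStar a hΦ) hIS r :
            ℝ → AngSpace) ξ = (freqLp (sepAtom a Φ 4) (continuous_sepAtom a hΦ 4) (hIA 4) r :
            ℝ → AngSpace) ξ from rfl] at hmk
        rw [hmk]
        ring
    rw [inner_neg_right] at hw
    linear_combination -hw
  -- atom 5: the azimuthal multiplier
  have e5 : ⟪oblateSphereBasis (2 * π) (a * (-2 * π * ξ)) q,
      (freqLp (sepAtom a Φ 5) (continuous_sepAtom a hΦ 5) (hIA 5) r : ℝ → AngSpace) ξ⟫_ℂ =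
      (Complex.I * q.1) * ⟪oblateSphereBasis (2 * π) (a * (-2 * π * ξ)) q, u₁⟫_ℂ :=
    inner_oblateSphereBasis_of_pair_mode (T := 2 * π) (a * (-2 * π * ξ)) q u₁
      ((freqLp (sepAtom a Φ 5) (continuous_sepAtom a hΦ 5) (hIA 5) r : ℝ → AngSpace) ξ)
      (fun m ↦ Complex.I * m) fun m k ↦ hPA (m, k)
  rw [e7, e0, e6, e1, e3, e4, e5]
  simp only [inner_smul_right, sepCoef, Matrix.cons_val_zero, Matrix.cons_val_one,
    Matrix.cons_val]
  -- the algebra: `z = 2πiξ = -iω` with `ω = -2πξ`; the `x²`-terms cancel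
  rw [hz]
  push_cast
  linear_combination (((r : ℂ) ^ 2 + 2 * M * r) *
      ⟪oblateSphereBasis (2 * π) (a * (-2 * π * ξ)) q, u⟫_ℂ +
    (a : ℂ) ^ 2 * ⟪oblateSphereBasis (2 * π) (a * (-2 * π * ξ)) q, mulSqFst (2 * π) u⟫_ℂ) *
    (4 * π ^ 2 * ξ ^ 2) * Complex.I_sq

end Main

end Kerr

end Literature.Geometry.Lorentzian
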